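/- Copyright: the b2b-balaban cell (near-miss cell 7), T⁴-continuum fan-out, row-NE7b OWNER lineage `t4-ne7b-p1` (gen 102) —
(α)-instance, THE END AT THE TOWER, ROUNDED, PER-STEP SHAPE ON THE PERFORMED RANGE, BOTH RUNS FROM ONE TOWER FAMILY, part 2 of 2:
the road.  Released under the licence of the surrounding project. -/
import Summits.QuantumFields.BalabanUV.T4Continuum.Support.B16HistoryTowerStepRangeDataLWR

/-!
# (α)-INSTANCE — THE END AT THE TOWER, ROUNDED, PER-STEP SHAPE ON THE PERFORMED RANGE, BOTH RUNS FROM ONE TOWER FAMILY, part 2: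
`toTowerR` (1R's rounded tower record from the range-form family record, by 3R-range, part 3 and IR-97-2's family theorems) and the
terminal theorem `continuumYM4Torus_of_towerStepRangeDisplays_fsc` := 2R ∘ `toTowerR`

Summits-side support leaf of the T⁴-continuum cell (rung (B)+1 on a FINITE torus only; NOT infinite volume, NOT the mass gap, NOT
Clay; NOT a proof of NE7b — the cell's OWN estimate `T4WeightBudget.RelWeightBound`, NOT PRINTED, NOT PROVED).  [folklore] one
record-valued `def`, three `rfl` tables, one composed theorem (1 def + 4 thm); no `[cite:]` tag, no `Prop` minted, zero `sorry`.  INTERFACE REQUEST NE7b IR-102-2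
(OWNER `t4-ne7b-p1` g102, RULING W-ne7bp1-g102-2), second half.

WHAT.  §1 `TowerStepRangeDataLWR.toTowerR : TowerReadDataLWR … P X 𝒢 μ (skelFam Sd.T Sd.p₀) (fun K => X K K) μ (fun K => 𝒢 K K)` —
every field of 1R's record BY NAME from the family record (`{ Sd with … }`), except: `sB := B16HistoryStepJunction.sBsharp (runsOf D g₀)
Sd.c` (print's sharp birth letter); `hw := B16HistoryTowerEndPrintedRRange.hw_of_stepDisplays_rounded_cubeCount_range …` (3R-range:
J4.2 + the cube-count chain at the rounded renewal letter ON THE PERFORMED RANGE, fed `Sd.hβ Sd.hdisp Sd.hclass Sd.hΩ Sd.hcube Sd.hℓ1`,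
the constants rows `Sd.hC' Sd.hC380 Sd.hcΛc`, the tables `Sd.hd Sd.hR Sd.hP` and the sign rows `hMΛ hℓ`); `hsB :=
B16HistoryTowerEndPrinted.hsB_of_tables …` (part 3); and RUN B AS THE FAMILY AT CUTOFF `K + 1` (Δ2): `RB := reprFam …`, `ρB := fun K t =>
densFam Sd.T Sd.ρ₀ (K + 1) t`, `holdsB := holdsFam … (K + 1)` (IR-97-2's «(1.72) holds» for the family), `intB := Sd.intA (K + 1)`, `H2B
:= Sd.H2A (K + 1)` (the window `K₀ ≤ K ⇒ K₀ ≤ K + 1`).  `toTowerR_data` ∕ `toTowerR_runB` ∕ `toTowerR_Φf` (`rfl` tables).  §2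
`continuumYM4Torus_of_towerStepRangeDisplays_fsc` = 2R's `continuumYM4Torus_of_towerReadingLWR_fsc` with the `Nonempty` payload
`TowerStepRangeDataLWR … P X 𝒢 μ` (FOUR existential carriers instead of eleven; same ten window letters, same conclusion), proof `2R ∘
ForSmallCouplings.mono ∘ toTowerR`.  NET, HONEST: a consumer holding (A1c)'s tower family with print's per-step sentences at its
PERFORMED steps' carriers (plus the class junction, the two chain links, the padding display, the letter tables, the truncation and the
remaining displayed rows) gets the headline predicate with no lemma application of its own; nothing of Bałaban's is asserted, valued
or discharged; NE7b NOT proved; count 0∕9.  HONEST DEPENDENCY (cell): continuum YM on T⁴ ⇐ BetaPertH ∧ nine spine estimates (0/9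
proved); BetaPertH ⇐ (D1) ∧ (D4) ∧ CAP+tail; G-an2-4 gates asym, D1 and NE2/3/4.  Unchanged here.
-/

open Finset MeasureTheory
open Literature.MathematicalPhysics.QuantumFieldTheory.Balaban1983to89
open T4PersistenceDictionary T4PersistentHistoryCount T4BankedInduction T4PrintedShapeBanking
open T4WeightBudget T4GlobalDenominator T4LiveClassFibration T4LiveStructureGas T4LiveGasToTerms T4RecordPriceSeam
open T4PartnerMultiplicity T4IndicatorShell T4MatchingAssembly T4MatchingClosure T4MatchingClosureSocket T4Continuum
open T4StabilitySocket T4BranchingRecordsGas T4TaggedShapeBanking T4CanonicalMenus T4RenewalChains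
open Summit.QuantumFields.BalabanUV.T4Continuum.PlacementBatch Summit.QuantumFields.BalabanUV.T4Continuum.PlacementSkeleton
open Summit.QuantumFields.BalabanUV.T4Continuum.CountThresholdUniform Summit.QuantumFields.BalabanUV.T4Continuum.CountThresholdExit
open Summit.QuantumFields.BalabanUV.T4Continuum.CountSeamJunction Summit.QuantumFields.BalabanUV.T4Continuum.LateMergers
open Summit.QuantumFields.BalabanUV.T4Continuum.HistoryFlow Summit.QuantumFields.BalabanUV.T4Continuum.HistoryRegeneration
open Summit.QuantumFields.BalabanUV.T4Continuum.HistoryTables Summit.QuantumFields.BalabanUV.T4Continuum.HistoryAssemblyTrees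
open Summit.QuantumFields.BalabanUV.T4Continuum.HistoryAssemblyTerms Summit.QuantumFields.BalabanUV.T4Continuum.HistoryAssemblyPedigree
open Summit.QuantumFields.BalabanUV.T4Continuum.HistoryConstants Summit.QuantumFields.BalabanUV.T4Continuum.HistoryGen
open Literature.MathematicalPhysics.QuantumFieldTheory.Balaban1983to89.B13ScaleTransfer
open Summit.QuantumFields.BalabanUV.T4Continuum.ZoneSkeleton Summit.QuantumFields.BalabanUV.T4Continuum.HistorySocketTH
open Summit.QuantumFields.BalabanUV.T4Continuum.HistoryCaps Summit.QuantumFields.BalabanUV.T4Continuum.HistoryAssemblyPrice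
open Summit.QuantumFields.BalabanUV.T4Continuum.HistoryBankingLE Summit.QuantumFields.BalabanUV.T4Continuum.HistoryExitLE
open Summit.QuantumFields.BalabanUV.T4Continuum.HistoryAssemblyTreesLE Summit.QuantumFields.BalabanUV.T4Continuum.HistoryAssemblyTermsLE
open Summit.QuantumFields.BalabanUV.T4Continuum.HistoryRealise Summit.QuantumFields.BalabanUV.T4Continuum.HistoryAssemblyRealiseLE
open Summit.QuantumFields.BalabanUV.T4Continuum.HistoryAssemblyMult Summit.QuantumFields.BalabanUV.T4Continuum.HistoryAssemblyMultKey
open Summit.QuantumFields.BalabanUV.T4Continuum.HistoryAssemblyRealiseRun Summit.QuantumFields.BalabanUV.T4Continuum.HistoryAssemblyRealiseMult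
open Summit.QuantumFields.BalabanUV.T4Continuum.HistoryZones Summit.QuantumFields.BalabanUV.T4Continuum.HistoryRealiseCells
open Summit.QuantumFields.BalabanUV.T4Continuum.HistoryRealiseCellsRun Summit.QuantumFields.BalabanUV.T4Continuum.HistoryAssemblyRealiseRunMult
open Summit.QuantumFields.BalabanUV.T4Continuum.HistoryRealiseCellsRunMult Summit.QuantumFields.BalabanUV.T4Continuum.HistoryAssemblyMultInstance
open Summit.QuantumFields.BalabanUV.T4Continuum.HistoryJoinsPlacedMember Summit.QuantumFields.BalabanUV.T4Continuum.PlacementSkeleton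
open Summit.QuantumFields.BalabanUV.T4Continuum.HistoryJoinsPlacedMult Summit.QuantumFields.BalabanUV.T4Continuum.HistoryRealiseDistinct
open Summit.QuantumFields.BalabanUV.T4Continuum.HistoryRegionTemplates Summit.QuantumFields.BalabanUV.T4Continuum.HistoryCaps
open Summit.QuantumFields.BalabanUV.T4Continuum.HistoryZoneEvolve (cth)
open Literature.MathematicalPhysics.QuantumFieldTheory.Balaban1983to89.B16SProfile (DropCtl)
open Summit.QuantumFields.BalabanUV.T4Continuum.HistoryRealiseCellsRunMultEnd Summit.QuantumFields.BalabanUV.T4Continuum.HistoryRealiseCellsRunMultEndD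
open Summit.QuantumFields.BalabanUV.T4Continuum.HistoryRealiseCellsRunPinnedT3b Summit.QuantumFields.BalabanUV.T4Continuum.HistoryHybridRescale
open Summit.QuantumFields.BalabanUV.T4Continuum.HistoryRealiseCellsRunApex (exists_const_schemeZ)
open Summit.QuantumFields.BalabanUV.T4Continuum.HistoryRealisePrint Summit.QuantumFields.BalabanUV.T4Continuum.HistoryRealiseWeak
open Summit.QuantumFields.BalabanUV.T4Continuum.HistoryRealisePrintReading Summit.QuantumFields.BalabanUV.T4Continuum.HistoryRealiseWeakReading
open Summit.QuantumFields.BalabanUV.T4Continuum.HistoryRealisePrintCells Summit.QuantumFields.BalabanUV.T4Continuum.HistoryRealiseWeakCells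
open Summit.QuantumFields.BalabanUV.T4Continuum.HistoryRealiseCellsRunApexT3b Summit.QuantumFields.BalabanUV.T4Continuum.HistoryRealiseCellsRunApexT3bW
open Summit.QuantumFields.BalabanUV.T4Continuum.HistoryRealiseCellsRunApexT3bWT Summit.QuantumFields.BalabanUV.T4Continuum.HistoryRealiseCellsRunPinnedT3bWT
open Summit.QuantumFields.BalabanUV.T4Continuum.HistoryRealiseCellsRunHeadlineT3bWT
open Summit.QuantumFields.BalabanUV.T4Continuum.HistoryRealiseCellsRunApexT3bWTV Summit.QuantumFields.BalabanUV.T4Continuum.HistoryBankingVolumePlug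
open Summit.QuantumFields.BalabanUV.T4Continuum.HistoryRealiseCellsRunApexT3bWTVS
open Summit.QuantumFields.BalabanUV.T4Continuum.HistoryGenealogyRealise
open Summit.QuantumFields.BalabanUV.T4Continuum.HistoryGenealogyInstantiate
open Summit.QuantumFields.BalabanUV.T4Continuum.B16HistoryIndexedRepr
open Summit.QuantumFields.BalabanUV.T4Continuum.B16HistoryIndexedTrunc
open Summit.QuantumFields.BalabanUV.T4Continuum.HistoryBankingDiscountCharge
open Summit.QuantumFields.BalabanUV.T4Continuum.HistoryBankingCreditRead
open Summit.QuantumFields.BalabanUV.T4Continuum.HistoryBankingFibreRoom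
open Summit.QuantumFields.BalabanUV.T4Continuum.HistoryPriceKeys
open Summit.QuantumFields.BalabanUV.T4Continuum.HistoryRealiseCellsRunSupplyWTVS
open Summit.QuantumFields.BalabanUV.T4Continuum.HistoryRealiseCellsRunSupplyKeysWTVS
open Summit.QuantumFields.BalabanUV.T4Continuum.HistoryRealiseCellsRunAssemblyWTVSData
open Summit.QuantumFields.BalabanUV.T4Continuum.HistoryRealiseCellsRunAssemblyWTVSDataL
open Summit.QuantumFields.BalabanUV.T4Continuum.HistoryRealiseCellsRunAssemblyWTVSDataLW
open Summit.QuantumFields.BalabanUV.T4Continuum.HistoryRealiseCellsRunAssemblyWTVSL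
open Summit.QuantumFields.BalabanUV.T4Continuum.HistoryRealiseCellsRunApexT3bWTVSL
open Summit.QuantumFields.BalabanUV.T4Continuum.HistoryBankingSharpShares (sBsharp)
open Summit.QuantumFields.BalabanUV.T4Continuum.HistoryBankingRoundingSupply (ellStar)
open Summit.QuantumFields.BalabanUV.T4Continuum.HistoryBankingRoundingUnrounded (sRunr ApFlat)
open Summit.QuantumFields.BalabanUV.T4Continuum.HistoryBankingRoundingTuned
open Summit.QuantumFields.BalabanUV.T4Continuum.HistoryBankingVolumeWindow
open Summit.QuantumFields.BalabanUV.T4Continuum.HistoryBankingVolumeSupply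
open Summit.QuantumFields.BalabanUV.T4Continuum.HistoryBankingForestVolume
open Summit.QuantumFields.BalabanUV.T4Continuum.HistoryBankingForestPlug
open Summit.QuantumFields.BalabanUV.T4Continuum.HistoryBankingAnchors82
open Summit.QuantumFields.BalabanUV.T4Continuum.HistoryBankingShrunkLedger82
open Summit.QuantumFields.BalabanUV.T4Continuum.HistoryBankingShrunkWitness82
open Summit.QuantumFields.BalabanUV.T4Continuum.HistoryBankingVolumeWindowCollar
open Summit.QuantumFields.BalabanUV.T4Continuum.HistoryBankingVolumeWindowShrunk82
open Summit.QuantumFields.BalabanUV.T4Continuum.B16HistoryWeightPlugW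
open Summit.QuantumFields.BalabanUV.T4Continuum.HistoryRealiseCellsRunSupplyWTVSW
open Summit.QuantumFields.BalabanUV.T4Continuum.HistoryRealiseCellsRunAssemblyWTVSDataLP
open Summit.QuantumFields.BalabanUV.T4Continuum.HistoryRealiseCellsRunAssemblyWTVSLW
open Summit.QuantumFields.BalabanUV.T4Continuum.HistoryRealiseCellsRunAssemblyWTVSLP
open Summit.QuantumFields.BalabanUV.T4Continuum.HistoryBankingVolumeWindowLattice
open Summit.QuantumFields.BalabanUV.T4Continuum.HistoryRealiseCellsRunAssemblyWTVSLWP82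
open Summit.QuantumFields.BalabanUV.T4Continuum.HistoryRealiseCellsRunAssemblyWTVSDataLWL
open Literature.MathematicalPhysics.QuantumFieldTheory.Balaban1983to89.TreeLength Literature.MathematicalPhysics.QuantumFieldTheory.Balaban1983to89.B16MergeGeometry
open Summit.QuantumFields.BalabanUV.T4Continuum.HistoryAdmissible Summit.QuantumFields.BalabanUV.T4Continuum.HistoryGenealogyExtraction
open Summit.QuantumFields.BalabanUV.T4Continuum.HistoryGenealogyPedigree Summit.QuantumFields.BalabanUV.T4Continuum.HistoryTouchComponents
open Summit.QuantumFields.BalabanUV.T4Continuum.HistoryBankingSharpShares (ell)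
open Summit.QuantumFields.BalabanUV.T4Continuum.HistoryBankingRoundingSupply
open Summit.QuantumFields.BalabanUV.T4Continuum.B16HistoryReprChain Summit.QuantumFields.BalabanUV.T4Continuum.B16HistoryReprInstance
open Summit.QuantumFields.BalabanUV.T4Continuum.B16HistoryReprRead Summit.QuantumFields.BalabanUV.T4Continuum.B16HistoryReprReadCausal
open Summit.QuantumFields.BalabanUV.T4Continuum.B16HistoryStepDisplayPinned
open Summit.QuantumFields.BalabanUV.T4Continuum.HistoryRealiseCellsRunAssemblyWTVSLWLP82
open Summit.QuantumFields.BalabanUV.T4Continuum.B16HistoryTowerEndDataLWL Summit.QuantumFields.BalabanUV.T4Continuum.B16HistoryTowerEndDataLWR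
open Literature.MathematicalPhysics.QuantumFieldTheory.Balaban1983to89.B16StepFactorsPrinted
open Literature.MathematicalPhysics.QuantumFieldTheory.Balaban1983to89.B16LargeFieldFactors380 (minConst)
open T4PrintedShapeBanking T4Continuum
open Literature.MathematicalPhysics.QuantumFieldTheory.Balaban1983to89.TreeLength
open Literature.MathematicalPhysics.QuantumFieldTheory.Balaban1983to89.B16MergeGeometry
open Summit.QuantumFields.BalabanUV.T4Continuum.HistoryConstants
open Summit.QuantumFields.BalabanUV.T4Continuum.HistoryAdmissible
open Summit.QuantumFields.BalabanUV.T4Continuum.HistoryGenealogyExtraction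
open Summit.QuantumFields.BalabanUV.T4Continuum.B16HistoryReprChain
open Summit.QuantumFields.BalabanUV.T4Continuum.B16HistoryReprInstance
open Summit.QuantumFields.BalabanUV.T4Continuum.B16HistoryReprReadCausal
open Summit.QuantumFields.BalabanUV.T4Continuum.B16HistoryStepJunction
open Summit.QuantumFields.BalabanUV.T4Continuum.B16HistoryTowerEndDataLWL
open Summit.QuantumFields.BalabanUV.T4Continuum.B16HistoryTowerEndDataLWR
open Summit.QuantumFields.BalabanUV.T4Continuum.B16HistoryTowerEndPrinted
open Summit.QuantumFields.BalabanUV.T4Continuum.HistoryBankingVolumeWindowLattice (uvolL)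
open Summit.QuantumFields.BalabanUV.T4Continuum.B16HistoryTowerEndPrintedR
open Summit.QuantumFields.BalabanUV.T4Continuum.B16HistoryTowerEndLWRP82
open Summit.QuantumFields.BalabanUV.T4Continuum.B16HistoryTowerEndPrintedRRange
open Summit.QuantumFields.BalabanUV.T4Continuum.B16HistoryTowerStepRangeDataLWR

namespace Summit.QuantumFields.BalabanUV.T4Continuum.B16HistoryTowerStepRangeLWRP82

noncomputable section

set_option synthInstance.maxSize 1024

/-! ## §1 The rounded tower record from the range-form family record -/

section Embed

variable {F : T4Family} {G : Type*} [GaugeGroup G] [MeasurableSpace G] [HaarData G] [RegularGaugeGroup G]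
  {D : FiniteEpsData F G} {C : T4PrintedShapeBanking.Consts} {O : PrintedO1s} {θv : ℝ} {rr d n : ℕ} {hn : 0 < n}
  {g₀ : ℕ → ℝ} {os : List (ULoop F)} {cΛ M Φ β₀ : ℝ} {p₁ η η' κ κ₂ κᵥ : ℕ}
  {P : Type} [DecidableEq P] {X : ℕ → ℕ → Type} {𝒢 : (K j : ℕ) → GoodClass (X K j)}
  [∀ K, MeasurableSpace (X K K)] {μ : (K : ℕ) → Measure (X K K)} [∀ K, IsFiniteMeasure (μ K)]

/-- **THE ROUNDED TOWER RECORD FROM THE RANGE-FORM FAMILY RECORD** (IR-102-2's `toTowerR`): every field of `TowerReadDataLWR` BY NAME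
from `Sd` at run B's parameters `I' := skelFam Sd.T Sd.p₀`, `Y K := X K K`, `νB := μ`, `𝒢' K := 𝒢 K K`; the birth letter `sB :=
B16HistoryStepJunction.sBsharp (runsOf D g₀) Sd.c`, the pinned display `hw` by 3R-range's `hw_of_stepDisplays_rounded_cubeCount_range` (ON
THE PERFORMED RANGE, at the rounded renewal letter, ON THE NOSE under the tables), the birth floor `hsB` by part 3's `hsB_of_tables`, and
run B's five slots by the family's own theorems at cutoff `K + 1` (`reprFam`, `densFam`, `holdsFam`, `intA`, `H2A`).  No letter weakened
or strengthened. [folklore] -/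
def _root_.Summit.QuantumFields.BalabanUV.T4Continuum.B16HistoryTowerStepRangeDataLWR.TowerStepRangeDataLWR.toTowerR
    (Sd : TowerStepRangeDataLWR D C O θv rr d n hn g₀ os cΛ M Φ β₀ p₁ η η' κ κ₂ κᵥ P X 𝒢 μ) :
    TowerReadDataLWR D C O θv rr d n hn g₀ os cΛ M Φ β₀ p₁ η η' κ κ₂ κᵥ P X 𝒢 μ (skelFam Sd.T Sd.p₀) (fun K => X K K) μ
      (fun K => 𝒢 K K) :=
  { Sd with
    sB := B16HistoryStepJunction.sBsharp (runsOf D g₀) Sd.c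
    hw := hw_of_stepDisplays_rounded_cubeCount_range D O p₁ g₀ Sd.T Sd.𝒮 Sd.c Sd.Xs cΛ M Sd.hMΛ Sd.hC' Sd.hC380 Sd.hcΛc Sd.hℓ
      Sd.hℓ1 Sd.hβ Sd.hdisp Sd.hclass Sd.hΩ Sd.hcube Sd.hd Sd.hR Sd.hP
    hsB := fun K j d' => hsB_of_tables D g₀ O Sd.m C Sd.c Sd.hγc Sd.hAc Sd.hpc Sd.hγ₀.le Sd.hmc K j d'
    RB := reprFam Sd.T Sd.p₀ Sd.ρ₀ Sd.hρ₀ Sd.h0 Sd.B Sd.hB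
    ρB := fun K t => densFam Sd.T Sd.ρ₀ (K + 1) t
    holdsB := fun K t V => holdsFam Sd.T Sd.p₀ Sd.ρ₀ Sd.hρ₀ Sd.h0 Sd.B Sd.hB Sd.hp₀ (K + 1) t V
    intB := fun K t a ι hι => Sd.intA (K + 1) t a ι hι
    H2B := fun K t ht hK => Sd.H2A (K + 1) t ht (Nat.le_succ_of_le hK) }

omit [RegularGaugeGroup G] in
/-- `toTowerR` pins: the tower, the small-field choices, the reading, the cutoff, the source radius and the truncation ARE the family
record's, and the birth letter IS print's sharp one (all `rfl`). [folklore] -/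
theorem _root_.Summit.QuantumFields.BalabanUV.T4Continuum.B16HistoryTowerStepRangeDataLWR.TowerStepRangeDataLWR.toTowerR_data
    (Sd : TowerStepRangeDataLWR D C O θv rr d n hn g₀ os cΛ M Φ β₀ p₁ η η' κ κ₂ κᵥ P X 𝒢 μ) :
    Sd.toTowerR.T = Sd.T ∧ Sd.toTowerR.p₀ = Sd.p₀ ∧ Sd.toTowerR.𝒮 = Sd.𝒮 ∧ Sd.toTowerR.K₀ = Sd.K₀ ∧ Sd.toTowerR.l₀ = Sd.l₀ ∧
      Sd.toTowerR.trunc = Sd.trunc ∧ Sd.toTowerR.sB = B16HistoryStepJunction.sBsharp (runsOf D g₀) Sd.c :=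
  ⟨rfl, rfl, rfl, rfl, rfl, rfl, rfl⟩

omit [RegularGaugeGroup G] in
/-- `toTowerR`'s RUN B IS THE FAMILY AT THE NEXT CUTOFF: its operations are `reprFam …` and its final density at `K` is `densFam … (K+1)`
(both `rfl`). [folklore] -/
theorem _root_.Summit.QuantumFields.BalabanUV.T4Continuum.B16HistoryTowerStepRangeDataLWR.TowerStepRangeDataLWR.toTowerR_runB
    (Sd : TowerStepRangeDataLWR D C O θv rr d n hn g₀ os cΛ M Φ β₀ p₁ η η' κ κ₂ κᵥ P X 𝒢 μ) :
    Sd.toTowerR.RB = reprFam Sd.T Sd.p₀ Sd.ρ₀ Sd.hρ₀ Sd.h0 Sd.B Sd.hB ∧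
      Sd.toTowerR.ρB = fun K t => densFam Sd.T Sd.ρ₀ (K + 1) t :=
  ⟨rfl, rfl⟩

omit [RegularGaugeGroup G] in
/-- `toTowerR`'s factor bundle IS the pinned bundle at print's sharp birth letter and the rounded renewal letter (`rfl`). [folklore] -/
theorem _root_.Summit.QuantumFields.BalabanUV.T4Continuum.B16HistoryTowerStepRangeDataLWR.TowerStepRangeDataLWR.toTowerR_Φf
    (Sd : TowerStepRangeDataLWR D C O θv rr d n hn g₀ os cΛ M Φ β₀ p₁ η η' κ κ₂ κᵥ P X 𝒢 μ) :
    Sd.toTowerR.Φf = factorsPinned Sd.T Sd.p₀ Sd.𝒮 Sd.B (B16HistoryStepJunction.sBsharp (runsOf D g₀) Sd.c)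
      (sRrnd D O p₁ g₀ Sd.𝒮.R) cΛ M (gsOf D g₀) Sd.hcΛ Sd.hMΛ Sd.hℓ :=
  rfl

end Embed

/-! ## §2 The terminal theorem: the headline from SOME range-form family record, for all small couplings -/

section SU

variable {F : T4Family} {N : ℕ} [NeZero N] {ℰ : LoopAverage (Matrix.specialUnitaryGroup (Fin N) ℂ)}

/-- **THE HEADLINE PREDICATE FROM A TOWER FAMILY CARRYING PRINT's PER-STEP SENTENCES AT ITS PERFORMED STEPS' CARRIERS, BOTH RUNS READ
OFF THE FAMILY**: `ContinuumYM4Torus D` for (0.4)-block-averaged data on `SU(N)` with a measurable small-loop average, GIVEN `(B)` and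
`BetaPertHyp` BY NAME, the sign conventions, the `_fsc` family's constants-only side conditions, TEN window-threshold letters `cΛ M Φ b₀
p₁ η η′ κ κ₂ κᵥ` (bound here), and — for all small-coupling tuned runs and every loop string — SOME range-form family record
`TowerStepRangeDataLWR … P X 𝒢 μ` (four carriers).  Proof: 2R's `continuumYM4Torus_of_towerReadingLWR_fsc` ∘ `ForSmallCouplings.mono` ∘
§1 `toTowerR`.  CONDITIONAL on everything the record displays ((A1c) = which tower family, carriers and truncation are Bałaban's); NE7b
NOT proved; count 0∕9. [folklore] -/
theorem continuumYM4Torus_of_towerStepRangeDisplays_fsc (D : FiniteEpsData F (Matrix.specialUnitaryGroup (Fin N) ℂ))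
    (hBA : D.IsBlockAveraged ℰ) (hE : ℰ.MeasurableE)
    (hB : B16.EndStatementBPrinted D.C) (hβ : BetaPertHyp D.βfun) (hsign : B16.SignConventions D.C)
    {C : T4PrintedShapeBanking.Consts} {O : PrintedO1s}
    {rr : ℕ} {β₀ : ℝ} (h : ThresholdOK C F.L rr β₀) (hμ : 0 < C.μ) (d n : ℕ)
    (hκ₁ : (d : ℝ) * Real.log F.L + 2 * Real.log 2 ≤ C.κ₁) (hE₀ : Real.log (2 + birthMass C) ≤ C.E₀)
    (hA₀ : 1 ≤ C.A₀) (hβ₀ : 0 < β₀) (hLβ : (F.L : ℝ) * β₀ ≤ 1) (hn₁ : 13 ≤ C.n₁) (hn : 0 < n)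
    {θ θv : ℝ} (hθ : 0 < θ) (hslack : C.a + (θ + θv) ≤ O.γ₀ * O.A₁ ^ 2 / 2)
    (hE₂ : 0 < C.E₂) (hE₃ : 0 ≤ C.E₃) {sS : ℕ} (hsS : 1 ≤ sS)
    (hsmall : (((2 * cth 32 1 sS + 1) ^ d : ℕ) : ℝ) * (5 : ℝ) ^ d * ((max 1 (2 * 32 + 2) : ℕ) : ℝ) ≤
      (F.L : ℝ) ^ (sS / 2) / 2)
    {θc : ℝ} (hθc0 : 0 ≤ θc) (hθc1 : θc < 1) (hθcs : 1 / 2 ≤ θc ^ sS)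
    {cΛ M Φ b₀ : ℝ} {p₁ η η' κ κ₂ κᵥ : ℕ}
    (hRead : T4ContinuumYM4Torus.ForSmallCouplings D fun g₀ => ∀ os : List (ULoop F),
        ∃ (P : Type) (_ : DecidableEq P) (X : ℕ → ℕ → Type) (𝒢 : (K j : ℕ) → GoodClass (X K j))
          (_ : ∀ K, MeasurableSpace (X K K)) (μ : (K : ℕ) → Measure (X K K)) (_ : ∀ K, IsFiniteMeasure (μ K)),
          Nonempty (TowerStepRangeDataLWR D C O θv rr d n hn g₀ os cΛ M Φ b₀ p₁ η η' κ κ₂ κᵥ P X 𝒢 μ)) :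
    T4ContinuumYM4Torus.ContinuumYM4Torus D :=
  continuumYM4Torus_of_towerReadingLWR_fsc D hBA hE hB hβ hsign h hμ d n hκ₁ hE₀ hA₀ hβ₀ hLβ hn₁ hn hθ hslack hE₂ hE₃ hsS
    hsmall hθc0 hθc1 hθcs
    (hRead.mono fun g₀ hg os => by
      obtain ⟨P, iP, X, 𝒢, mX, μ, hμf, ⟨Sd⟩⟩ := hg os
      exact ⟨P, iP, X, 𝒢, mX, μ, hμf, fun _ => Unit, skelFam Sd.T Sd.p₀, fun K => X K K, inferInstance, μ, hμf,
        fun K => 𝒢 K K, ⟨Sd.toTowerR⟩⟩)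

end SU

end

end Summit.QuantumFields.BalabanUV.T4Continuum.B16HistoryTowerStepRangeLWRP82
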